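import Summits.AtomisticToContinuum.Crystallization.Theorems.FluxTubeKeplerFloorGivesLayered
import Summits.AtomisticToContinuum.Crystallization.Theorems.FluxTubeKeplerFluxCellKeplerSingleScale
import Summits.AtomisticToContinuum.Crystallization.Theorems.ChessboardParticlePlanesPeriodicWindowsIffCrystallization
import Summits.AtomisticToContinuum.Crystallization.Theorems.FluxTubeKeplerKeplerEnergyFloor
import Summits.AtomisticToContinuum.Crystallization.Theorems.ThreeConeCertificateSlackRigidityPricedFloorsDefs

/-!
# Line `PosTolRung` (tolerance ladder) — skeleton for the forward rung over `FluxTubeKepler.FloorGivesLayered`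
(crux dir `FluxCellKepler`, stmt-AtomisticToContinuum-15221; fwd-rung G1, seed g1-AtomisticToContinuum-15223)

Stubs (the only `sorry`s): `stub_hullTemplate` (fixed-tolerance hull extraction), `stub_hullRegularity`
(ε-REGULARITY OF NEAR-LAYERED HULL SETS — the bet), `stub_cleanBallsGiveWindows` (clean hull balls ⇒ good sites
at every scale); composition `PosTolRung_of` is sorry-free (Steps 2–3 of the seed re-run as `hasLayeredWindows_of_good`,
then the proved `PeriodicGivenLayered`).

FLOOR (proved, `FluxTubeKeplerFloorGivesLayered.FloorGivesLayered_proof`): for every periodic `P₀`,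
the energy floor `N·e(P₀) ≤ E(x)` on Lennard-Jones ground states together with the defect BUDGET
`c(R,η)·#{(R,η)-non-layered sites} ≤ E(x) − N·e(P₀)` AT EVERY radius `R` AND EVERY tolerance `η > 0`
forces layered windows (hence, by the proved `PeriodicGivenLayered`, periodic windows) along every
ground-state sequence.  Its proof is tolerance-blind counting: the budget at `(R,η)` leaves an
`(R,η)`-good site for `N` large (`eventually_exists_not_bad`), nothing ever improves a tolerance.

THE GRADED FAMILY `TolRung η₀` (ONE move: the budget hypothesis is asked only at tolerances `η ≥ η₀`;
the conclusion is the periodic-windows clause of `FluxTubeKepler.PeriodicWindows` for the sequence):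
* `TolRung 0` is the floor (`tolRung_zero`, from the seed + `PeriodicGivenLayered_holds`);
* `TolRung` is ANTITONE (`tolRung_anti`: a budget at more tolerances is a stronger hypothesis);
* every member is a consequence of the sub-problem (`tolRung_of_crystallization`, on-path lemma, via the
  landed `periodicWindows_of_crystallization`);
* deciding rung `PosTolRung := ∃ η₀ > 0, TolRung η₀` — "a defect budget at SOME fixed positive tolerance
  already forces crystallization of the ground states": the infimum of the fixed-tolerance members, the
  statement closest to the floor that the floor's counting cannot reach (from `(R,η₀)`-goodness of all but
  `o(N)` sites one never gets an `(R,ε)`-good site for `ε < η₀` by counting; the new input is an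
  ε-regularity / rigidity statement IN THE HULL of the ground-state sequence, see `Lines/PosTolRung.lean`);
* fixed member `TolRungTwentieth := TolRung (1/20)` (PhononSlack's handover tolerance) ⇒ `PosTolRung`.
The sub-problem `Crystallization` is not a member: it implies every member and sits above `TolRung η₀`
for every `η₀` (the top of the family, "FLOOR alone ⇒ periodic windows", is still formally below it).
-/

noncomputable section

namespace Summit.AtomisticToContinuum.Crystallization.Cruxes.FluxCellKepler.ToleranceLadder

open Filter Topology
open Literature.MathematicalPhysics.StatisticalMechanics
open Summit.AtomisticToContinuum.Crystallization.Theorems.FluxCellKeplerSingleScale (LayeredGood)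

local notation "E3" => EuclideanSpace ℝ (Fin 3)

/-- FLOOR(P₀): `N · e(P₀) ≤ E(x)` for every Lennard-Jones ground state `x` of every size `N`
(verbatim the first hypothesis of `FluxTubeKepler.FloorGivesLayered`). -/
def Floor (P₀ : PeriodicConfiguration 3) : Prop :=
  ∀ (N : ℕ) (x : Fin N → E3), IsGroundState lennardJones x →
    (N : ℝ) * P₀.energyPerParticle lennardJones ≤ interactionEnergy lennardJones x

/-- BUDGET(P₀) AT TOLERANCES `η ≥ η₀`: for every radius `R > 0` and every tolerance `η ≥ η₀`, `η > 0`,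
some `c > 0` prices the `(R,η)`-non-layered sites of every Lennard-Jones ground state against the excess
energy over `N · e(P₀)` (`LayeredGood` is the crux's defect predicate, verbatim; `η₀ = 0` is the floor's
budget at every tolerance). -/
def Budget (η₀ : ℝ) (P₀ : PeriodicConfiguration 3) : Prop :=
  ∀ R η : ℝ, 0 < R → η₀ ≤ η → 0 < η → ∃ c : ℝ, 0 < c ∧
    ∀ (N : ℕ) (x : Fin N → E3), IsGroundState lennardJones x →
      c * (Nat.card {i : Fin N // ¬ LayeredGood R η x i} : ℝ) ≤
        interactionEnergy lennardJones x - (N : ℝ) * P₀.energyPerParticle lennardJones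

/-- Periodic windows at every scale along the sequence `x` (ONE periodic `P`, translations only) —
verbatim the conclusion of `FluxTubeKepler.PeriodicWindows` / `FluxTubeKepler.PeriodicGivenLayered`. -/
def HasPeriodicWindows (x : (N : ℕ) → (Fin N → E3)) : Prop :=
  ∃ P : PeriodicConfiguration 3, ∀ R ε : ℝ, 0 < ε → ∃ᶠ N in atTop, ∃ t : E3,
    (∀ s ∈ P.points, ‖s‖ ≤ R → ∃ i : Fin N, dist (x N i + t) s ≤ ε) ∧
    (∀ i : Fin N, ‖x N i + t‖ ≤ R → ∃ s ∈ P.points, dist (x N i + t) s ≤ ε)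

/-- **The graded family.** `TolRung η₀`: FLOOR and the defect budget at tolerances `η ≥ η₀` (all radii)
force periodic windows along every Lennard-Jones ground-state sequence. -/
def TolRung (η₀ : ℝ) : Prop :=
  ∀ P₀ : PeriodicConfiguration 3, Floor P₀ → Budget η₀ P₀ →
    ∀ x : (N : ℕ) → (Fin N → E3), (∀ N, IsGroundState lennardJones (x N)) → HasPeriodicWindows x

/-- **Deciding rung (candidate 1).** A defect budget at SOME fixed positive tolerance suffices. -/
def PosTolRung : Prop := ∃ η₀ : ℝ, 0 < η₀ ∧ TolRung η₀

/-- **Fixed member (candidate 2).** The budget at tolerances `η ≥ 1/20` suffices. -/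
def TolRungTwentieth : Prop := TolRung (1 / 20)

/-! ## F3 — the family specialises to the proved floor -/

/-- `TolRung 0` is the floor: the seed theorem followed by the proved `PeriodicGivenLayered`. -/
theorem tolRung_zero : TolRung 0 := fun P₀ hF hB x hx =>
  Theses.FluxTubeKepler.PeriodicGivenLayered_holds x hx
    (Theorems.FluxTubeKeplerFloorGivesLayered.FloorGivesLayered_proof P₀ hF
      (fun R η hR hη => hB R η hR hη.le hη) x hx)

/-! ## Dial monotonicity (harder-to-easier = decreasing tolerance) -/

/-- `TolRung` is antitone in the tolerance. -/
theorem tolRung_anti {η₀ η₁ : ℝ} (h : η₀ ≤ η₁) : TolRung η₁ → TolRung η₀ :=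
  fun H P₀ hF hB x hx => H P₀ hF (fun R η hR hη₁ hη => hB R η hR (h.trans hη₁) hη) x hx

/-- Every fixed positive member gives the deciding rung. -/
theorem posTolRung_of_tolRung {η₀ : ℝ} (hη₀ : 0 < η₀) (h : TolRung η₀) : PosTolRung := ⟨η₀, hη₀, h⟩

theorem posTolRung_of_tolRungTwentieth (h : TolRungTwentieth) : PosTolRung :=
  posTolRung_of_tolRung (by norm_num) h

/-- The deciding rung gives back the floor (informational `specialises`). -/
theorem tolRung_zero_of_posTolRung (h : PosTolRung) : TolRung 0 := by
  obtain ⟨η₀, hη₀, hR⟩ := h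
  exact tolRung_anti hη₀.le hR

/-! ## F4 — on-path lemmas: the sub-problem implies every member -/

/-- ON-PATH: `Crystallization → TolRung η₀` (landed hull-criterion converse
`periodicWindows_of_crystallization`). -/
theorem tolRung_of_crystallization (η₀ : ℝ) (h : _root_.Crystallization) : TolRung η₀ :=
  fun _ _ _ x hx =>
    Theorems.ChessboardParticlePlanesPeriodicWindowsIffCrystallization.periodicWindows_of_crystallization h x hx

/-- ON-PATH for the deciding rung (tagged `aesop safe apply` so that the tribunal's fixed
`S → C` portfolio — `simpa using h`, `aesop` — finds it). -/
@[aesop safe apply]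
theorem PosTolRung_of_Crystallization (h : _root_.Crystallization) : PosTolRung :=
  ⟨1, one_pos, tolRung_of_crystallization 1 h⟩

/-- ON-PATH for the fixed member (same tags). -/
@[aesop safe apply]
theorem TolRungTwentieth_of_Crystallization (h : _root_.Crystallization) : TolRungTwentieth :=
  tolRung_of_crystallization _ h

/-! ## How the rung relieves the parent crux `FluxCellKepler` (documentation, sorry-free)

With `TolRung η₀` in hand the route `FluxTubeKepler` needs its Kepler-type budget only at tolerances
`η ≥ η₀`: `CoarseKeplerFloor η₀` below is the conclusion of the PROVED `KeplerEnergyFloor` with the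
tolerance quantifier cut at `η₀`, and `TolRung η₀ → CoarseKeplerFloor η₀ → Crystallization`. -/

/-- The floor-and-budget package at tolerances `≥ η₀` (what a fixed-tolerance Kepler inequality delivers). -/
def CoarseKeplerFloor (η₀ : ℝ) : Prop := ∃ P₀ : PeriodicConfiguration 3, Floor P₀ ∧ Budget η₀ P₀

theorem crystallization_of_tolRung {η₀ : ℝ} (h : TolRung η₀) (hK : CoarseKeplerFloor η₀) :
    _root_.Crystallization := by
  obtain ⟨P₀, hF, hB⟩ := hK
  exact Theorems.ChessboardParticlePlanesPeriodicWindowsIffCrystallization.crystallization_of_periodicWindows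
    (fun x hx => h P₀ hF hB x hx)

/-- The parent crux gives the package at every tolerance (proved `KeplerEnergyFloor` + minimal distance). -/
theorem coarseKeplerFloor_of_fluxCellKepler (η₀ : ℝ) (hK : Theses.FluxTubeKepler.FluxCellKepler) :
    CoarseKeplerFloor η₀ := by
  obtain ⟨P₀, hF, hB⟩ := Theorems.keplerEnergyFloor_proof hK LennardJonesMinimalDistance_holds
  exact ⟨P₀, hF, fun R η hR _ hη => hB R η hR hη⟩


/-! ## The line: tolerance bootstrap through the hull

Notation.  `InHull x Y`: the set `Y` is a window limit (translations only, frequently in `N`) of the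
sequence `x` — the hull format of `LayeredHull.stub_windowBounds` / `stub_extraction`.
`NearTemplate η Y`: `Y` is GLOBALLY two-way `η`-close to ONE admissible layered set
(`SlackRigidityPricedFloors.layeredSet`, `IsAdmissibleLayering` = the crux's box, set form).
`LayeredAt 2 2 ε Y p` (`SlackRigidityPricedFloors`): the radius-2 neighbourhood of `p` in `Y` is two-way
`ε`-layered (with ITS OWN admissible parameters — relaxation inside the box is allowed). -/

/-- `Y` lies in the hull of the sequence `x` (two-way `ε`-matching on every ball after a translation,
frequently in `N`). -/
def InHull (x : (N : ℕ) → (Fin N → E3)) (Y : Set E3) : Prop :=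
  ∀ R ε : ℝ, 0 < ε → ∃ᶠ N in atTop, ∃ t : E3,
    (∀ p ∈ Y, ‖p‖ ≤ R → ∃ i : Fin N, dist (x N i + t) p ≤ ε) ∧
    (∀ i : Fin N, ‖x N i + t‖ ≤ R → ∃ p ∈ Y, dist (x N i + t) p ≤ ε)

open Summit.AtomisticToContinuum.Crystallization.Theorems.SlackRigidityPricedFloors (layeredSet
  IsAdmissibleLayering LayeredAt)

/-- `Y` is globally two-way `η`-near ONE admissible layered set. -/
def NearTemplate (η : ℝ) (Y : Set E3) : Prop :=
  ∃ (A : E3 →ₗᵢ[ℝ] E3) (a : ℝ) (s : ℤ → ℤ) (z : ℤ → ℝ), IsAdmissibleLayering a s z ∧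
    (∀ p ∈ layeredSet A a s z, ∃ q ∈ Y, dist q p ≤ η) ∧
    (∀ q ∈ Y, ∃ p ∈ layeredSet A a s z, dist q p ≤ η)

/-- `Y` contains, for every tolerance `ε > 0` and every radius, a ball CENTRED AT A POINT OF `Y` all of
whose points are `(2, 2, ε)`-layered in `Y`. -/
def CleanBalls (Y : Set E3) : Prop :=
  ∀ ε : ℝ, 0 < ε → ∀ R' : ℝ, ∃ p₀ ∈ Y, ∀ p ∈ Y, dist p p₀ ≤ R' → LayeredAt 2 2 ε Y p

/-! ### The declared stubs (the only `sorry`s of the file) -/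

/-- **Stub 1 — fixed-tolerance hull extraction (compactness).** If along a Lennard-Jones ground-state
sequence, at EVERY radius `R`, frequently in `N` some site is `(R, η₀)`-layered-good, then some set `Y`
in the hull of the sequence is globally two-way `η₀`-near ONE admissible layered set.  (Recentring at
the good sites, local Hausdorff compactness of uniformly discrete sets — `LennardJonesMinimalDistance` —
and compactness of the template data `(A, a, s, z)` after normalising the layer index, as in the landed
`LayeredHull.stub_extraction`; the matching passes to the limit with the same tolerance.) [folklore] -/
theorem stub_hullTemplate :
    ∀ η₀ : ℝ, 0 < η₀ → ∀ x : (N : ℕ) → (Fin N → E3), (∀ N, IsGroundState lennardJones (x N)) →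
      (∀ R : ℝ, 0 < R → ∃ᶠ N in atTop, ∃ i : Fin N, LayeredGood R η₀ (x N) i) →
      ∃ Y : Set E3, InHull x Y ∧ NearTemplate η₀ Y := by
  sorry

/-- **Stub 2 — ε-regularity of near-layered hull sets (THE BET; load-bearing).** There is a tolerance
`η₀ > 0` such that, whenever some periodic `P₀` satisfies FLOOR (so `E_GS(n) ≥ n·e*`: finite clusters
are never below the bulk energy), every hull set `Y` of a Lennard-Jones ground-state sequence that is
globally `η₀`-near one admissible layered set contains, for every `ε > 0`, arbitrarily large balls
centred in `Y` on which EVERY point is `(2, 2, ε)`-layered.  Intended proof: (i) screening — by the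
window bounds of hull sets (`LayeredHull.stub_windowBounds`, landed) and FLOOR, the energy of `Y ∩ B_R`
inside `Y` is `2·e*·#(Y ∩ B_R) + O(R²)`; (ii) coercivity of the Lennard-Jones energy near the relaxed
Barlow family modulo the family's own modes (spacing, registry, interlayer gaps): on near-layered sets the
`O(R²)` excess controls `κ(ε)·#{(2,ε)-non-layered points of B_R}`; (iii) so non-layered points have
density `O(1/R)` and pigeonhole gives clean balls.  May fail if (ii) fails: a bounded, non-family,
energy-neutral modulation of a Barlow stacking (a zero mode of the relaxed family beyond spacing /
registry / gaps).  Perturbative sibling of the OPEN cruxes `PhononSlackCertificates.NearFieldConvexity`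
(13958) and `ExcessDecayLiouville.PhononStability` (9333), in hull form. [conjecture] -/
theorem stub_hullRegularity :
    ∃ η₀ : ℝ, 0 < η₀ ∧ ∀ P₀ : PeriodicConfiguration 3, Floor P₀ →
      ∀ x : (N : ℕ) → (Fin N → E3), (∀ N, IsGroundState lennardJones (x N)) →
        ∀ Y : Set E3, InHull x Y → NearTemplate η₀ Y → CleanBalls Y := by
  sorry

/-- **Stub 3 — clean hull balls give good sites at every scale (chart gluing + transfer).** If a set
`Y` in the hull of a Lennard-Jones ground-state sequence `x` has clean balls, then at every scale
`(R, η)`, frequently in `N`, some site of `x N` is `(R, η)`-layered-good.  (Set version of the landed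
compactness-rigidity `FluxCellKeplerSingleScale.good_of_locallyGood` — all points `(2, η')`-layered on
an `R'`-ball ⇒ the centre is `(R, η/2)`-layered — transported to `x N` through the `InHull` matching
with tolerance loss `η/2`; uniform discreteness from `LennardJonesMinimalDistance`.) [folklore] -/
theorem stub_cleanBallsGiveWindows :
    ∀ x : (N : ℕ) → (Fin N → E3), (∀ N, IsGroundState lennardJones (x N)) →
      ∀ Y : Set E3, InHull x Y → CleanBalls Y →
        ∀ R η : ℝ, 0 < R → 0 < η → ∃ᶠ N in atTop, ∃ i : Fin N, LayeredGood R η (x N) i := by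
  sorry

/-! ### The stub statements as named propositions (verbatim) -/

/-- Statement of `stub_hullTemplate` (verbatim). [folklore] -/
def Sig.stub_hullTemplate : Prop :=
    ∀ η₀ : ℝ, 0 < η₀ → ∀ x : (N : ℕ) → (Fin N → E3), (∀ N, IsGroundState lennardJones (x N)) →
      (∀ R : ℝ, 0 < R → ∃ᶠ N in atTop, ∃ i : Fin N, LayeredGood R η₀ (x N) i) →
      ∃ Y : Set E3, InHull x Y ∧ NearTemplate η₀ Y

/-- Statement of `stub_hullRegularity` (verbatim). [conjecture] -/
def Sig.stub_hullRegularity : Prop :=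
    ∃ η₀ : ℝ, 0 < η₀ ∧ ∀ P₀ : PeriodicConfiguration 3, Floor P₀ →
      ∀ x : (N : ℕ) → (Fin N → E3), (∀ N, IsGroundState lennardJones (x N)) →
        ∀ Y : Set E3, InHull x Y → NearTemplate η₀ Y → CleanBalls Y

/-- Statement of `stub_cleanBallsGiveWindows` (verbatim). [folklore] -/
def Sig.stub_cleanBallsGiveWindows : Prop :=
    ∀ x : (N : ℕ) → (Fin N → E3), (∀ N, IsGroundState lennardJones (x N)) →
      ∀ Y : Set E3, InHull x Y → CleanBalls Y →
        ∀ R η : ℝ, 0 < R → 0 < η → ∃ᶠ N in atTop, ∃ i : Fin N, LayeredGood R η (x N) i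

/-! ### Sorry-free glue -/

/-- BUDGET at tolerances `≥ η₀` + FLOOR ⇒ at every radius, frequently in `N`, an `(R, η₀)`-good site
(the seed's counting step `eventually_exists_not_bad`, run at the one priced tolerance). [folklore] -/
theorem coarseGood_of_budget {η₀ : ℝ} (hη₀ : 0 < η₀) {P₀ : PeriodicConfiguration 3} (hF : Floor P₀)
    (hB : Budget η₀ P₀) (x : (N : ℕ) → (Fin N → E3)) (hx : ∀ N, IsGroundState lennardJones (x N)) :
    ∀ R : ℝ, 0 < R → ∃ᶠ N in atTop, ∃ i : Fin N, LayeredGood R η₀ (x N) i := by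
  intro R hR
  obtain ⟨c, hc, hcN⟩ := hB R η₀ hR le_rfl hη₀
  have hev := Theorems.FluxTubeKeplerFloorGivesLayered.eventually_exists_not_bad P₀ hF
    (bad := fun N x i => ¬ LayeredGood R η₀ x i) hc hcN
  refine (hev.mono fun N hN => ?_).frequently
  obtain ⟨i, hi⟩ := hN (x N) (hx N)
  exact ⟨i, not_not.1 hi⟩

open Summit.AtomisticToContinuum.Crystallization.Theorems.FluxTubeKeplerFloorGivesLayered
  (spacing_selection match_dilate layered_pt_scale) in
/-- Steps 2–3 of the seed, isolated: good sites at every scale (with scale-dependent spacings) give the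
layered-windows hypothesis of `FluxTubeKepler.PeriodicGivenLayered` (one spacing by `spacing_selection`,
transfer by dilation `match_dilate` + `layered_pt_scale`, translation `t := −x N i`). [folklore] -/
theorem hasLayeredWindows_of_good (x : (N : ℕ) → (Fin N → E3))
    (hgood : ∀ R η : ℝ, 0 < R → 0 < η → ∃ᶠ N in atTop, ∃ i : Fin N, LayeredGood R η (x N) i) :
    ∃ a : ℝ, 47 / 50 ≤ a ∧ a ≤ 1 ∧ ∀ R ε : ℝ, 0 < ε → ∃ᶠ N in Filter.atTop,
      ∃ (A : E3 →ₗᵢ[ℝ] E3) (t : E3) (s : ℤ → ℤ) (z : ℤ → ℝ), IsHaggSeq s ∧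
      (∀ m : ℤ, 39 / 50 * a ≤ z (m + 1) - z m ∧ z (m + 1) - z m ≤ 17 / 20 * a) ∧
      let S : Set E3 := {p | ∃ m i j : ℤ, p = A (((i : ℝ) • triangularVec₁ a) +
        ((j : ℝ) • triangularVec₂ a) + ((haggLabel s m : ℝ) • barlowOffset a) + (z m • layerNormal 1))};
      (∀ p ∈ S, ‖p‖ ≤ R → ∃ i : Fin N, dist (x N i + t) p ≤ ε) ∧
      (∀ i : Fin N, ‖x N i + t‖ ≤ R → ∃ p ∈ S, dist (x N i + t) p ≤ ε) := by
  -- Step 2: one spacing for all scales, the transfer being dilation of the whole layered datum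
  have hgood' : ∀ R η : ℝ, 0 < R → 0 < η → ∃ᶠ N in atTop, ∃ i : Fin N, ∃ a : ℝ, 47 / 50 ≤ a ∧ a ≤ 1 ∧
      ∃ (A : E3 →ₗᵢ[ℝ] E3) (s : ℤ → ℤ) (z : ℤ → ℝ), IsHaggSeq s ∧
        (∀ m : ℤ, 39 / 50 * a ≤ z (m + 1) - z m ∧ z (m + 1) - z m ≤ 17 / 20 * a) ∧
        let S : Set E3 := {p | ∃ m k l : ℤ, p = A (((k : ℝ) • triangularVec₁ a) +
          ((l : ℝ) • triangularVec₂ a) + ((haggLabel s m : ℝ) • barlowOffset a) + (z m • layerNormal 1))};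
        (∀ p ∈ S, ‖p‖ ≤ R → ∃ j : Fin N, dist (x N j - x N i) p ≤ η) ∧
        (∀ j : Fin N, ‖x N j - x N i‖ ≤ R → ∃ p ∈ S, dist (x N j - x N i) p ≤ η) := hgood
  obtain ⟨a, ha1, ha2, hwin⟩ := spacing_selection hgood' fun R ε hR hε => by
    obtain ⟨η₁, hη₁0, hη₁ε, hη₁1⟩ : ∃ η₁ : ℝ, 0 < η₁ ∧ η₁ ≤ ε ∧ η₁ ≤ 1 :=
      ⟨min ε 1, lt_min hε one_pos, min_le_left _ _, min_le_right _ _⟩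
    have hR1 : 0 < R + 1 := by linarith
    obtain ⟨θ, hθ0, hθR⟩ : ∃ θ : ℝ, 0 < θ ∧ θ * (R + 1) = η₁ / 2 :=
      ⟨η₁ / 2 / (R + 1), by positivity, by field_simp⟩
    refine ⟨47 / 50 * θ, by positivity, R + 1, η₁ / 2, by positivity, ?_⟩
    intro a b R' η' ha hb hab hRR' hη' N i hG
    obtain ⟨A, s, z, hs, hbox, hM₁, hM₂⟩ := hG
    have ha0 : 0 < a := by linarith
    have hb0 : 0 < b := by linarith
    obtain ⟨ρ, hρ0, hρb⟩ : ∃ ρ : ℝ, 0 < ρ ∧ ρ * b = a :=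
      ⟨a / b, div_pos ha0 hb0, div_mul_cancel₀ a hb0.ne'⟩
    have habs : |b - a| < 47 / 50 * θ := hab
    have h1ρ : |1 - ρ| ≤ θ := by
      have e1 : 1 - ρ = (b - a) / b := by rw [← hρb]; field_simp
      rw [e1, abs_div, abs_of_pos hb0, div_le_iff₀ hb0]
      nlinarith [abs_nonneg (b - a)]
    have h1ρ' : |ρ⁻¹ - 1| ≤ θ := by
      have e1 : ρ⁻¹ - 1 = (b - a) / a := by rw [← hρb]; field_simp
      rw [e1, abs_div, abs_of_pos ha0, div_le_iff₀ ha0]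
      nlinarith [abs_nonneg (b - a)]
    refine ⟨A, s, fun m => ρ * z m, hs, fun m => ?_, ?_⟩
    · obtain ⟨hl, hu⟩ := hbox m
      have hl' := mul_le_mul_of_nonneg_left hl hρ0.le
      have hu' := mul_le_mul_of_nonneg_left hu hρ0.le
      constructor
      · calc 39 / 50 * a = ρ * (39 / 50 * b) := by rw [← hρb]; ring
          _ ≤ ρ * (z (m + 1) - z m) := hl'
          _ = ρ * z (m + 1) - ρ * z m := by ring
      · calc ρ * z (m + 1) - ρ * z m = ρ * (z (m + 1) - z m) := by ring
          _ ≤ ρ * (17 / 20 * b) := hu'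
          _ = 17 / 20 * a := by rw [← hρb]; ring
    · have hscale : ∀ m k l : ℤ, A (((k : ℝ) • triangularVec₁ a) + ((l : ℝ) • triangularVec₂ a) +
          ((haggLabel s m : ℝ) • barlowOffset a) + ((ρ * z m) • layerNormal 1)) =
          ρ • A (((k : ℝ) • triangularVec₁ b) + ((l : ℝ) • triangularVec₂ b) +
          ((haggLabel s m : ℝ) • barlowOffset b) + (z m • layerNormal 1)) := by
        intro m k l
        rw [← hρb]
        exact layered_pt_scale A ρ b s z m k l
      dsimp only
      refine match_dilate (fun j => x N j - x N i) _ _ hθ0 hθR hη₁ε hη₁1 hρ0 h1ρ h1ρ' hRR' hη'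
        ?_ ?_ hM₁ hM₂
      · rintro p ⟨m, k, l, rfl⟩
        exact ⟨m, k, l, (hscale m k l).symm⟩
      · rintro p' ⟨m, k, l, rfl⟩
        exact ⟨_, ⟨m, k, l, rfl⟩, hscale m k l⟩
  -- Step 3: read the fixed-spacing good site at radius `max R 1` and translate by `t := -x N i`
  refine ⟨a, ha1, ha2, fun R ε hε => ?_⟩
  have hR' : 0 < max R 1 := lt_max_of_lt_right one_pos
  refine (hwin (max R 1) ε hR' hε).mono fun N hN => ?_
  obtain ⟨i, hi⟩ := hN
  obtain ⟨A, s, z, hs, hbox, hM₁, hM₂⟩ := hi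
  refine ⟨A, -x N i, s, z, hs, hbox, ?_⟩
  have hsub : ∀ j : Fin N, x N j + -x N i = x N j - x N i := fun j =>
    (sub_eq_add_neg (x N j) (x N i)).symm
  intro S
  refine ⟨fun p hp hpR => ?_, fun j hj => ?_⟩
  · obtain ⟨j, hj⟩ := hM₁ p hp (hpR.trans (le_max_left R 1))
    exact ⟨j, by rw [hsub j]; exact hj⟩
  · rw [hsub j] at hj ⊢
    exact hM₂ j (hj.trans (le_max_left R 1))

/-! ### The skeleton theorem: the rung BY NAME from the three stub statements (sorry-free) -/

/-- **Assembly.** `stub_hullTemplate → stub_hullRegularity → stub_cleanBallsGiveWindows → PosTolRung`: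
take the `η₀` of Stub 2; under FLOOR and the budget at tolerances `≥ η₀`, every radius has
`(R, η₀)`-good sites (`coarseGood_of_budget`), hence a hull set globally `η₀`-near one template
(Stub 1), which has clean balls (Stub 2), hence good sites at EVERY scale (Stub 3), hence layered
windows (`hasLayeredWindows_of_good`) and periodic windows (proved `PeriodicGivenLayered`). -/
theorem PosTolRung_of (h₁ : Sig.stub_hullTemplate) (h₂ : Sig.stub_hullRegularity)
    (h₃ : Sig.stub_cleanBallsGiveWindows) : PosTolRung := by
  obtain ⟨η₀, hη₀, hreg⟩ := h₂
  refine ⟨η₀, hη₀, fun P₀ hF hB x hx => ?_⟩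
  obtain ⟨Y, hY, hnear⟩ := h₁ η₀ hη₀ x hx (coarseGood_of_budget hη₀ hF hB x hx)
  have hgood := h₃ x hx Y hY (hreg P₀ hF x hx Y hY hnear)
  exact Theses.FluxTubeKepler.PeriodicGivenLayered_holds x hx (hasLayeredWindows_of_good x hgood)

/-- **The closed skeleton instance**: the rung by name from the three declared stubs (the only
`sorry`s of this file enter here). [conjecture] -/
theorem PosTolRung_skeleton : PosTolRung :=
  PosTolRung_of stub_hullTemplate stub_hullRegularity stub_cleanBallsGiveWindows

end Summit.AtomisticToContinuum.Crystallization.Cruxes.FluxCellKepler.ToleranceLadder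

end
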